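import Summits.AtomisticToContinuum.FouriersLaw.Theorems.VanishingNoiseTransferNoisyFourierAbelTimeProfile

/-!
# Time-profile matching from the flip time-profile thermodynamic limit: the glue `T2 → TPM`
(`--supports stmt-AtomisticToContinuum-11977` helper file, crux `VanishingNoiseTransfer.NoisyFourier`, line
`abel-storage-decay`, registered stub TPM `stub_timeProfileMatching`; lead c7 reshape of the skeleton: TPM = T1 ∧ T2 with
T1 landed, so that T2 becomes the registered stub `stub_flipTimeProfileTL` and TPM is derived in the skeleton as
`helper_timeProfileMatchingOfFlipTimeProfileTL stub_flipTimeProfileTL`)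

Setting: the pinned anharmonic chain `𝐏 = pinnedChain ω₂ lam β γ` (all parameters `> 0`) with velocity flips at rate
`ε > 0`, both Langevin baths at `T > 0`, Gibbs measure `μ_T = 𝐏.gibbsMeasure L T`, total current `J_L = Σ_i j_i`,
CLASSICAL Abel correctors `u ∈ C² ∩ L²(μ_T)` with `L_ε u = s u − J_L` pointwise (`s > 0`), pairing `σ_L(s) = ∫ J_L u dμ_T`.

The registered stub TPM `stub_timeProfileMatching` asks for `B`, measurable profiles `c_L` and a limit profile `C` with
`|c_L(t)| ≤ B(L − 1)` (`L ≥ 2`, `t > 0`), `c_L(t)/(L − 1) → C(t)` for a.e. `t > 0`, and `σ_L(s) = ∫₀^∞ e^{-st} c_L(t) dt`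
for every `L ≥ 2`, `s > 0` and every classical Abel corrector `u` at `s`. Its fixed-`L` half T1 is LANDED in family form
(`AbelTimeProfile.abelTimeProfile_of_family`, …NoisyFourierAbelTimeProfile): for EVERY admissible family `V = (V_L)_{L ≥ 1}`
of equilibrium flip semigroups — Markov, jointly measurable, `μ_T`-invariant, and satisfying the Laplace–Neumann identity
(7) of `VanishingNoiseBound.exists_flipSemigroup_gibbs` (the four spec clauses of `helper_flipSemigroupGibbs`; THE
Dyson–Phillips flip semigroups delivered there are such a family) — the profile
`c_L(t) = ⟨J_L, V_{L,t} J_L⟩_{μ_T} = ∫ J_L(z) (∫ J_L dV_{L,t⁺}(z, ·)) dμ_T(z)` is measurable, `O(L − 1)`-bounded and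
Laplace-represents every classical Abel pairing. What is left of TPM is its thermodynamic-limit half

  (T2) FLIP TIME-PROFILE THERMODYNAMIC LIMIT, family form: for every admissible family `V` and a.e. `t > 0`, the
  per-length profile `c_L(t)/(L − 1)` (with `c_0 := 0`) converges as `L → ∞`

(flip light cone at fixed time + bulk window matching + uniqueness of the bulk equilibrium dynamics; the flip twin of the
registered deterministic stub `stub_fixedTimeMatching` of stmt-AtomisticToContinuum-14013). T2 is well posed: by T1 the
Laplace transform of the bounded measurable `c_L` is the same for all admissible families (classical Abel correctors
exist at every `s > 0`), so `c_L` is family-independent for a.e. `t`. This file lands the glue `T2 → TPM`: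

* `timeProfileMatching_of_flipTimeProfileTL` — T2 (an INLINE hypothesis, no definition) implies the signature of
  `stub_timeProfileMatching` verbatim: choose the flip semigroups of `exists_flipSemigroup_gibbs` for every `L ≥ 1`, let
  `c_L` be their profile (`c_0 ≡ 0`), take `B` and the three fixed-`L` clauses from `abelTimeProfile_of_family`, the a.e.
  convergence from T2 for the SAME family, and `C(t) := limUnder atTop (L ↦ c_L(t)/(L − 1))`;
* `helper_timeProfileMatchingOfFlipTimeProfileTL` (registered form) — the same, fully quantified and notation-free.

No definitions; axioms `propext`, `Classical.choice`, `Quot.sound` only. References: Bernardin–Olla 2011 §5 (time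
correlations and the Green–Kubo formula of the velocity-flip chain); folklore (Laplace representation of a contraction
semigroup at equilibrium; `Filter.limUnder`).
-/

noncomputable section

open MeasureTheory ProbabilityTheory Filter Topology Set Function
open scoped NNReal ENNReal BigOperators ContDiff
open Literature.MathematicalPhysics.KineticTheory.HeatConduction
open Literature.Probability.Process OscillatorChain
open Summit.AtomisticToContinuum.FouriersLaw.Theorems.VanishingNoiseBound (exists_flipSemigroup_gibbs)
open Summit.AtomisticToContinuum.FouriersLaw.Cruxes.NoisyFourier.AbelKapitzaEvenCorrector.AbelTimeProfile
  (abelTimeProfile_of_family)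

namespace Summit.AtomisticToContinuum.FouriersLaw.Cruxes.NoisyFourier.AbelStorageDecay

section Chain

variable {ω₂ lam β γ : ℝ}

/-- **Time-profile matching from the flip time-profile thermodynamic limit** (`T2 → TPM`). HYPOTHESIS T2 (flip
time-profile thermodynamic limit, family form; the flip twin of the deterministic registered stub
`stub_fixedTimeMatching` of stmt-AtomisticToContinuum-14013): for all parameters `ω₂, lam, β, γ, T, ε > 0` and EVERY
family `V = (V_L)_{L ≥ 1}` of Markov kernels on the `L`-particle phase spaces that is jointly measurable, leaves
`μ_T = gibbsMeasure L T` invariant and satisfies the Laplace–Neumann identity (7) of `exists_flipSemigroup_gibbs` (the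
four spec clauses of `abelTimeProfile_of_family`), the per-length profile
`(L − 1)⁻¹ ∫ J_L(z) (∫ J_L dV_{L,t⁺}(z, ·)) dμ_T(z)` (`:= 0` at `L = 0`) converges as `L → ∞` for a.e. `t > 0`.
CONCLUSION: the signature of the registered stub `stub_timeProfileMatching` — `B`, measurable profiles `c_L` with
`|c_L(t)| ≤ B(L − 1)` (`L ≥ 2`, `t > 0`), a limit profile `C` with `c_L(t)/(L − 1) → C(t)` for a.e. `t > 0`, and the
Laplace representation `∫ J_L u dμ_T = ∫₀^∞ e^{-st} c_L(t) dt` of every classical Abel pairing (`L ≥ 2`, `s > 0`).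
Proof: `c_L` = the profile of the flip semigroups of `exists_flipSemigroup_gibbs`, T1 = `abelTimeProfile_of_family`,
T2 for the same family, `C := limUnder`. [cite: BernardinOlla2011, §5] -/
theorem timeProfileMatching_of_flipTimeProfileTL
    (hT2 : ∀ (ω₂ lam β γ : ℝ) (hω : 0 < ω₂) (hl : 0 < lam) (hβ : 0 < β) (hγ : 0 < γ) (T : ℝ) (hT : 0 < T) (ε : ℝ),
      0 < ε → ∀ V : (L : ℕ) → 0 < L → ℝ≥0 → Kernel (PhaseSpace L) (PhaseSpace L),
      (∀ (L : ℕ) (hL : 0 < L) (t : ℝ≥0), IsMarkovKernel (V L hL t)) →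
      (∀ (L : ℕ) (hL : 0 < L), Measurable fun p : ℝ≥0 × PhaseSpace L => V L hL p.1 p.2) →
      (∀ (L : ℕ) (hL : 0 < L) (t : ℝ≥0),
        ((pinnedChain ω₂ lam β γ).gibbsMeasure L T).bind (V L hL t) = (pinnedChain ω₂ lam β γ).gibbsMeasure L T) →
      (∀ (L : ℕ) (hL : 0 < L) (a : ℝ), 0 < a → ∀ W : ℕ → Kernel (PhaseSpace L) (PhaseSpace L),
        W 0 = (pinnedChainSemigroup hω hl.le hβ.le hγ.le hL hT.le hT.le).resolventKernel (a + L * ε) →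
        (∀ n, W (n + 1) = (pinnedChainSemigroup hω hl.le hβ.le hγ.le hL hT.le hT.le).resolventKernel
          (a + L * ε) ∘ₖ (flipKernel L ∘ₖ W n)) →
        ∀ φ : PhaseSpace L → ℝ≥0∞, Measurable φ → ∀ z : PhaseSpace L,
          ∫⁻ t, ∫⁻ y, φ y ∂(V L hL t.toNNReal z) ∂(expMeasure a) =
            ∑' n, ENNReal.ofReal (a / (a + L * ε) * (L * ε / (a + L * ε)) ^ n) * ∫⁻ y, φ y ∂(W n z)) →
      ∀ᵐ t ∂(volume.restrict (Ioi (0 : ℝ))), ∃ K : ℝ, Tendsto (fun L : ℕ => (if hL : 0 < L then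
        ∫ z, (∑ i : Fin L, (pinnedChain ω₂ lam β γ).bondCurrent L i z) *
          ∫ y, (∑ i : Fin L, (pinnedChain ω₂ lam β γ).bondCurrent L i y) ∂(V L hL t.toNNReal z)
          ∂((pinnedChain ω₂ lam β γ).gibbsMeasure L T) else 0) / ((L : ℝ) - 1)) atTop (𝓝 K))
    (hω : 0 < ω₂) (hl : 0 < lam) (hβ : 0 < β) (hγ : 0 < γ) {T : ℝ} (hT : 0 < T) {ε : ℝ} (hε : 0 < ε) :
    ∃ B : ℝ, ∃ c : ℕ → ℝ → ℝ, ∃ C : ℝ → ℝ, (∀ L : ℕ, Measurable (c L)) ∧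
      (∀ L : ℕ, 2 ≤ L → ∀ t : ℝ, 0 < t → |c L t| ≤ B * ((L : ℝ) - 1)) ∧
      (∀ᵐ t ∂(volume.restrict (Ioi (0 : ℝ))), Tendsto (fun L : ℕ => c L t / ((L : ℝ) - 1)) atTop (𝓝 (C t))) ∧
      ∀ (L : ℕ), 2 ≤ L → ∀ s : ℝ, 0 < s → ∀ u : PhaseSpace L → ℝ,
        (ContDiff ℝ 2 u ∧ MemLp u 2 ((pinnedChain ω₂ lam β γ).gibbsMeasure L T) ∧
          ∀ x, (pinnedChain ω₂ lam β γ).flipGenerator L T T ε u x =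
            s * u x - ∑ i : Fin L, (pinnedChain ω₂ lam β γ).bondCurrent L i x) →
        ∫ x, (∑ i : Fin L, (pinnedChain ω₂ lam β γ).bondCurrent L i x) * u x
            ∂((pinnedChain ω₂ lam β γ).gibbsMeasure L T) =
          ∫ t in Ioi (0 : ℝ), Real.exp (-(s * t)) * c L t := by
  -- adapted from `AbelTimeProfile.abelTimeProfileRepresentation` (…NoisyFourierAbelTimeProfile): same semigroups and
  -- profile; the limit profile is `C := limUnder` of the a.e. convergent per-length profiles delivered by T2
  -- (i) the flip semigroups at equilibrium, one for every `L ≥ 1`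
  have hV : ∀ (L : ℕ) (hL : 0 < L), ∃ V : ℝ≥0 → Kernel (PhaseSpace L) (PhaseSpace L),
      (∀ t, IsMarkovKernel (V t)) ∧ (Measurable fun p : ℝ≥0 × PhaseSpace L => V p.1 p.2) ∧
      (∀ t, ((pinnedChain ω₂ lam β γ).gibbsMeasure L T).bind (V t) = (pinnedChain ω₂ lam β γ).gibbsMeasure L T) ∧
      (∀ a : ℝ, 0 < a → ∀ W : ℕ → Kernel (PhaseSpace L) (PhaseSpace L),
        W 0 = (pinnedChainSemigroup hω hl.le hβ.le hγ.le hL hT.le hT.le).resolventKernel (a + L * ε) →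
        (∀ n, W (n + 1) = (pinnedChainSemigroup hω hl.le hβ.le hγ.le hL hT.le hT.le).resolventKernel
          (a + L * ε) ∘ₖ (flipKernel L ∘ₖ W n)) →
        ∀ φ : PhaseSpace L → ℝ≥0∞, Measurable φ → ∀ z : PhaseSpace L,
          ∫⁻ t, ∫⁻ y, φ y ∂(V t.toNNReal z) ∂(expMeasure a) =
            ∑' n, ENNReal.ofReal (a / (a + L * ε) * (L * ε / (a + L * ε)) ^ n) * ∫⁻ y, φ y ∂(W n z)) := by
    intro L hL
    obtain ⟨V, h1, -, -, h4, -, -, h7, h8⟩ := exists_flipSemigroup_gibbs hω hl.le hβ.le hγ.le hL hT hε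
    exact ⟨V, h1, h4, h7, h8⟩
  choose V hVM hVmeas hVinv hVlap using hV
  -- (ii) the profile `c_L(t) = ⟨J_L, V_{L,t} J_L⟩_{μ_T}` (`c_0 ≡ 0`) and its fixed-`L` theory T1
  set c : ℕ → ℝ → ℝ := fun L t => if hL : 0 < L then
      ∫ z, (∑ i : Fin L, (pinnedChain ω₂ lam β γ).bondCurrent L i z) *
        ∫ y, (∑ i : Fin L, (pinnedChain ω₂ lam β γ).bondCurrent L i y) ∂(V L hL t.toNNReal z)
        ∂((pinnedChain ω₂ lam β γ).gibbsMeasure L T) else 0 with hc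
  obtain ⟨B, hmeas, hbound, hrep⟩ := abelTimeProfile_of_family hω hl hβ hγ hT hε V hVM hVmeas hVinv hVlap c
    (fun L hL t => by simp only [hc, dif_pos hL])
    (by simpa only [hc, lt_self_iff_false, dif_neg, not_false_eq_true] using measurable_const)
  -- (iii) the thermodynamic-limit half T2 for the same family, and the limit profile `C := limUnder`
  have hlim := hT2 ω₂ lam β γ hω hl hβ hγ T hT ε hε V hVM hVmeas hVinv hVlap
  refine ⟨B, c, fun t => limUnder atTop fun L : ℕ => c L t / ((L : ℝ) - 1), hmeas, hbound, ?_, hrep⟩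
  filter_upwards [hlim] with t ht
  exact tendsto_nhds_limUnder ht

/-- **Registered helper `helper_timeProfileMatchingOfFlipTimeProfileTL`** of stmt-AtomisticToContinuum-11977 (line
`abel-storage-decay`, lead c7 reshape): the glue `T2 → TPM` = `timeProfileMatching_of_flipTimeProfileTL`, fully quantified and
notation-free — the flip time-profile thermodynamic limit in family form (for every admissible family of equilibrium flip
semigroups, a.e.-in-`t` convergence of the per-length current autocorrelation profile; the flip twin of the deterministic
registered stub `stub_fixedTimeMatching` of stmt-AtomisticToContinuum-14013) implies the registered signature of
`stub_timeProfileMatching` verbatim. [cite: BernardinOlla2011, §5] -/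
theorem helper_timeProfileMatchingOfFlipTimeProfileTL : (∀ (ω₂ lam β γ : ℝ) (hω : 0 < ω₂) (hl : 0 < lam) (hβ : 0 < β) (hγ : 0 < γ) (T : ℝ) (hT : 0 < T) (ε : ℝ), 0 < ε → ∀ V : (L : ℕ) → 0 < L → NNReal → ProbabilityTheory.Kernel (Literature.MathematicalPhysics.KineticTheory.HeatConduction.PhaseSpace L) (Literature.MathematicalPhysics.KineticTheory.HeatConduction.PhaseSpace L), (∀ (L : ℕ) (hL : 0 < L) (t : NNReal), ProbabilityTheory.IsMarkovKernel (V L hL t)) → (∀ (L : ℕ) (hL : 0 < L), Measurable fun p : NNReal × Literature.MathematicalPhysics.KineticTheory.HeatConduction.PhaseSpace L => V L hL p.1 p.2) → (∀ (L : ℕ) (hL : 0 < L) (t : NNReal), ((Literature.MathematicalPhysics.KineticTheory.HeatConduction.pinnedChain ω₂ lam β γ).gibbsMeasure L T).bind (V L hL t) = (Literature.MathematicalPhysics.KineticTheory.HeatConduction.pinnedChain ω₂ lam β γ).gibbsMeasure L T) → (∀ (L : ℕ) (hL : 0 < L) (a : ℝ), 0 < a → ∀ W : ℕ → ProbabilityTheory.Kernel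 (Literature.MathematicalPhysics.KineticTheory.HeatConduction.PhaseSpace L) (Literature.MathematicalPhysics.KineticTheory.HeatConduction.PhaseSpace L), W 0 = (Literature.MathematicalPhysics.KineticTheory.HeatConduction.pinnedChainSemigroup hω (le_of_lt hl) (le_of_lt hβ) (le_of_lt hγ) hL (le_of_lt hT) (le_of_lt hT)).resolventKernel (a + (L : ℝ) * ε) → (∀ n, W (n + 1) = ProbabilityTheory.Kernel.comp ((Literature.MathematicalPhysics.KineticTheory.HeatConduction.pinnedChainSemigroup hω (le_of_lt hl) (le_of_lt hβ) (le_of_lt hγ) hL (le_of_lt hT) (le_of_lt hT)).resolventKernel (a + (L : ℝ) * ε)) (ProbabilityTheory.Kernel.comp (Literature.MathematicalPhysics.KineticTheory.HeatConduction.flipKernel L) (W n))) → ∀ φ : Literature.MathematicalPhysics.KineticTheory.HeatConduction.PhaseSpace L → ENNReal, Measurable φ → ∀ z : Literature.MathematicalPhysics.KineticTheory.HeatConduction.PhaseSpace L, MeasureTheory.lintegral (ProbabilityTheory.expMeasure a) (fun t => MeasureTheory.lintegral (V L hL t.toNNReal z) (fun y => φ y)) = ∑' n, ENNReal.ofReal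 (a / (a + (L : ℝ) * ε) * ((L : ℝ) * ε / (a + (L : ℝ) * ε)) ^ n) * MeasureTheory.lintegral (W n z) (fun y => φ y)) → Filter.Eventually (fun t : ℝ => ∃ K : ℝ, Filter.Tendsto (fun L : ℕ => (if hL : 0 < L then MeasureTheory.integral ((Literature.MathematicalPhysics.KineticTheory.HeatConduction.pinnedChain ω₂ lam β γ).gibbsMeasure L T) (fun z => (∑ i : Fin L, (Literature.MathematicalPhysics.KineticTheory.HeatConduction.pinnedChain ω₂ lam β γ).bondCurrent L i z) * MeasureTheory.integral (V L hL t.toNNReal z) (fun y => ∑ i : Fin L, (Literature.MathematicalPhysics.KineticTheory.HeatConduction.pinnedChain ω₂ lam β γ).bondCurrent L i y)) else 0) / ((L : ℝ) - 1)) Filter.atTop (nhds K)) (MeasureTheory.ae (MeasureTheory.volume.restrict (Set.Ioi (0 : ℝ))))) → ∀ (ω₂ lam β γ T ε : ℝ), 0 < ω₂ → 0 < lam → 0 < β → 0 < γ → 0 < T → 0 < ε → ∃ B : ℝ, ∃ c : ℕ → ℝ → ℝ, ∃ C : ℝ → ℝ, (∀ L : ℕ, Measurable (c L)) ∧ (∀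 L : ℕ, 2 ≤ L → ∀ t : ℝ, 0 < t → |c L t| ≤ B * ((L : ℝ) - 1)) ∧ (Filter.Eventually (fun t : ℝ => Filter.Tendsto (fun L : ℕ => c L t / ((L : ℝ) - 1)) Filter.atTop (nhds (C t))) (MeasureTheory.ae (MeasureTheory.volume.restrict (Set.Ioi (0 : ℝ))))) ∧ ∀ (L : ℕ), 2 ≤ L → ∀ s : ℝ, 0 < s → ∀ u : Literature.MathematicalPhysics.KineticTheory.HeatConduction.PhaseSpace L → ℝ, (ContDiff ℝ 2 u ∧ MeasureTheory.MemLp u 2 ((Literature.MathematicalPhysics.KineticTheory.HeatConduction.pinnedChain ω₂ lam β γ).gibbsMeasure L T) ∧ ∀ x, (Literature.MathematicalPhysics.KineticTheory.HeatConduction.pinnedChain ω₂ lam β γ).flipGenerator L T T ε u x = s * u x - ∑ i : Fin L, (Literature.MathematicalPhysics.KineticTheory.HeatConduction.pinnedChain ω₂ lam β γ).bondCurrent L i x) → MeasureTheory.integral ((Literature.MathematicalPhysics.KineticTheory.HeatConduction.pinnedChain ω₂ lam β γ).gibbsMeasure L T) (fun x => (∑ i : Fin L, (Literature.MathematicalPhysics.KineticTheory.HeatConduction.pinnedChain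 ω₂ lam β γ).bondCurrent L i x) * u x) = MeasureTheory.integral (MeasureTheory.volume.restrict (Set.Ioi (0 : ℝ))) (fun t => Real.exp (-(s * t)) * c L t) :=
  fun hT2 _ _ _ _ _ _ hω hl hβ hγ hT hε => timeProfileMatching_of_flipTimeProfileTL hT2 hω hl hβ hγ hT hε

end Chain

end Summit.AtomisticToContinuum.FouriersLaw.Cruxes.NoisyFourier.AbelStorageDecay

end
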